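import Literature.MathematicalPhysics.QuantumFieldTheory.BalabanImbrieJaffe1984to88.BIJ88Expansion5143Ordered
import Literature.MathematicalPhysics.QuantumFieldTheory.BalabanImbrieJaffe1984to88.BIJ88Ineq5113Covering

/-!
# `BalabanImbrieJaffe1984to88.BIJ88Expansion5143Connected` — T. Bałaban, J. Imbrie, A. Jaffe, *Effective action and cluster properties of the
abelian Higgs model*, Commun. Math. Phys. **114** (1988) 257–315 [BalabanImbrieJaffe1988], §5.14 p. 309 [PDF 53], verbatim (after the last display
of the page): *"Each X_γ must cover and connect all the t-derivatives specified by H_γ."* — **the CONNECTED-POLYMER families of the (5.14.3)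
expansion in the two connectivity vocabularies of the tree**, and gen 6's `N(K)` (`BIJ88ConnectedGraphResummation.Nsum`) RESTRICTED TO CONNECTED
POLYMERS: (i) the cluster connectivity `BIJ88PolymerRep5134.IsConn adj` of §5.13 (p. 306 *"such that X is a single cluster"*, used by
`BIJ88Expansion5143` §6) and the path connectivity `LatticeModels.IsRConnected adj` of the polymer families `BIJ88Ineq5113Covering.polys adj Λ`
(used by gen 5/6: `BIJ88W6PrimeBound`, `BIJ88RemainderW6Prime`, and by gen 9's `BIJ88TypedGasKP`) AGREE on nonempty sets for a symmetric abutting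
relation (`isConn_iff_isRConnected`, `polys_eq_filter_isConn`); (ii) `Nsum` does not see polymers on which the activity vanishes (`Nsum_restrict`);
(iii) hence gen 6's `N(K)` fed with the prime-dropped DERIVED activity `g₃′ = prime (g3 adj z)` may be taken over CONNECTED polymers only, in both
bookkeepings: over the virtual supports of the connected polymers it is the corner expectation `z K W W` of (5.14.3) (`Nsum_vsupp_conn_eq_corner`),
and over `polys adj W` with the plain overlap hard core (the instantiation of `BIJ88RemainderW6Prime`) it is the sum over ALL fillings of `W` of
`Π_β g₃(H_β, X_β)` (`Nsum_polys_eq_sum_setPartitions`) — the printed all-fillings form, which exceeds the cluster-configuration form `z K W W` exactly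
by the fillings violating the hard core among multi-cube polymers (`Nsum_polys_eq_corner_add`; READING NOTE GAPS.md G-C2-p25-03 of gen 8).

statement-level skeleton of published theorems with citation tags; proofs where landed; nothing here is a claim about the Yang–Mills mass gap

PDF held: `paper:balaban1988-cmp114-bij-abelian-higgs-effective-action` (journal page = PDF page + 256); p. 309 = PDF 53 (text `p0053.txt` L35,
render `lit-balaban-ref-1/renders/cmp114/original-p053-x2.png`).

WHAT IS REPRODUCED (unit `lit-balaban-p25`, generation 10 of the Phase-2 proof seat p25, file 4; SKELETON rows `C2.Eq5.14.3-5.14.4` and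
`C2.Claim@310` first clause of `HOME/lit-balaban-r16/ROWS-C2-part2.md`; HOME `run/shared/lean/pub/lit-balaban/`), theorems only:
* §1 `isConn_of_isRConnected` (any `adj`), `isRConnected_of_isConn` (symmetric `adj`, nonempty set), `isConn_iff_isRConnected`,
  `polys_eq_filter_isConn` (`polys adj W = (polysOf W).filter (IsConn adj)`): the elementary-region closure of `BIJ88Clusters5134.cluster` (smallest
  set closed under the active abutting pairs) against `Relation.ReflTransGen` paths.
* §2 `Nsum_restrict`: for `Q' ⊆ Q ∌ ∅` and an activity vanishing (for every slot set) on `Q ∖ Q'`, `Nsum Q loc w K = Nsum Q' loc w K`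
  (via gen 10's `Nsum_eq_sum_families`).
* §3 `Nsum_vsupp_conn_eq_corner` (cluster-configuration bookkeeping restricted to connected polymers = `z K W W`), `Nsum_polys_eq_sum_setPartitions`
  (overlap bookkeeping over `polys adj W` = the all-fillings sum), `Nsum_polys_eq_corner_add` (= `z K W W` + the hard-core-violating fillings).
HYPOTHESES: `adj` symmetric where the two connectivities are compared; in §3 the slot-local cluster-factorizing corner data of `BIJ88Expansion5143`
(`hz`, `hloc`) and `hK` (all slots located in `W`). Nothing analytic; (5.14.4) not asserted; 0 `sorry`, 0 new `Prop` facts; imports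
`BIJ88Expansion5143Ordered`, `BIJ88Ineq5113Covering` (for `polys`); modifies nothing. NOT summit progress; NOT continuum; NOT Clay.
Cell `lit-balaban` Phase 2, seat p25 gen 10 (owner r16, referee ref-5).
-/

open Finset
open Literature.Probability.LatticeModels (IsSetPartition setPartitions mem_setPartitions IsRConnected)
open Literature.MathematicalPhysics.QuantumFieldTheory.BalabanImbrieJaffe1984to88.BIJ88Clusters5134 (IsClusterFactorizing cluster cluster_subset
  activePairs mem_activePairs)
open Literature.MathematicalPhysics.QuantumFieldTheory.BalabanImbrieJaffe1984to88.BIJ88PolymerRep5134 (IsConn isConn_singleton IsAdmissible)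
open Literature.MathematicalPhysics.QuantumFieldTheory.BalabanImbrieJaffe1984to88.BIJ88ElementaryRegions304 (IsClosed region mem_region
  region_subset_of_isClosed)
open Literature.MathematicalPhysics.QuantumFieldTheory.BalabanImbrieJaffe1984to88.BIJ88Ineq5113Covering (polys mem_polys)
open Literature.MathematicalPhysics.QuantumFieldTheory.BalabanImbrieJaffe1984to88.BIJ88ConnectedGraphResummation (Nsum)
open Literature.MathematicalPhysics.QuantumFieldTheory.BalabanImbrieJaffe1984to88.BIJ88Expansion5143
open Literature.MathematicalPhysics.QuantumFieldTheory.BalabanImbrieJaffe1984to88.BIJ88Expansion5143Ordered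

namespace Literature.MathematicalPhysics.QuantumFieldTheory.BalabanImbrieJaffe1984to88.BIJ88Expansion5143Connected

/-! ## §1 The two connectivities of the tree agree: clusters (closure under abutting pairs) and `R`-paths -/

section Bridge

variable {ι : Type*} [DecidableEq ι] {adj : ι → ι → Prop} [DecidableRel adj]

/-- **path-connected ⇒ a single cluster**: an `adj`-path-connected set of cubes is connected in the sense of §5.13 (every cube's cluster, all cubes
active, is the whole set). [cite: BalabanImbrieJaffe1988, p.309 (Sect. 5.14)] -/
theorem isConn_of_isRConnected {X : Finset ι} (h : IsRConnected adj X) : IsConn adj X := by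
  intro i hi
  refine Subset.antisymm (cluster_subset adj X X i) fun w hw => ?_
  have key : ∀ w, Relation.ReflTransGen (fun x y => adj x y ∧ x ∈ X ∧ y ∈ X) i w →
      ∀ T ⊆ X, i ∈ T → IsClosed (activePairs adj X) X T → w ∈ T := by
    intro w hp
    induction hp with
    | refl => exact fun T _ hiT _ => hiT
    | @tail b c _ hbc ih =>
      intro T hT hiT hc
      obtain ⟨hadj, hbX, hcX⟩ := hbc
      have hbT : b ∈ T := ih T hT hiT hc
      by_cases hbc' : b = c
      · exact hbc' ▸ hbT
      · have hY : ({b, c} : Finset ι) ∈ activePairs adj X := (mem_activePairs adj).2 ⟨b, hbX, c, hcX, hbc', hadj, rfl⟩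
        have hsub := hc {b, c} hY ⟨b, mem_inter.2 ⟨mem_insert_self b {c}, hbT⟩⟩
        exact hsub (mem_inter.2 ⟨mem_insert_of_mem (mem_singleton_self c), hcX⟩)
  exact mem_region.2 ⟨hw, key w (h.2 i hi w hw)⟩

/-- **a single cluster ⇒ path-connected** (symmetric abutting relation, nonempty set). [cite: BalabanImbrieJaffe1988, p.309 (Sect. 5.14)] -/
theorem isRConnected_of_isConn (hR : ∀ x y, adj x y → adj y x) {X : Finset ι} (hX : X.Nonempty) (h : IsConn adj X) :
    IsRConnected adj X := by
  classical
  refine ⟨hX, fun v hv w hw => ?_⟩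
  set T : Finset ι := X.filter fun j => Relation.ReflTransGen (fun x y => adj x y ∧ x ∈ X ∧ y ∈ X) v j with hT
  have hTX : T ⊆ X := filter_subset _ _
  have hvT : v ∈ T := mem_filter.2 ⟨hv, Relation.ReflTransGen.refl⟩
  have hcl : IsClosed (activePairs adj X) X T := by
    intro Y hY hne y hy
    obtain ⟨j, hj, j', hj', -, hadj, rfl⟩ := (mem_activePairs adj).1 hY
    obtain ⟨k, hk⟩ := hne
    obtain ⟨hk, hkT⟩ := mem_inter.1 hk
    have hkr := (mem_filter.1 hkT).2
    obtain ⟨hy, hyX⟩ := mem_inter.1 hy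
    refine mem_filter.2 ⟨hyX, ?_⟩
    rw [mem_insert, mem_singleton] at hk hy
    rcases hk with rfl | rfl <;> rcases hy with rfl | rfl
    · exact hkr
    · exact hkr.tail ⟨hadj, hj, hj'⟩
    · exact hkr.tail ⟨hR _ _ hadj, hj', hj⟩
    · exact hkr
  have hXT : X ⊆ T := by
    have hreg := region_subset_of_isClosed hTX hvT hcl
    have hcv : cluster adj X X v = X := h v hv
    rw [← hcv]
    exact hreg
  exact (mem_filter.1 (hXT hw)).2

/-- **the two connectivities agree** on nonempty sets of cubes for a symmetric abutting relation. [cite: BalabanImbrieJaffe1988, p.309 (Sect. 5.14)] -/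
theorem isConn_iff_isRConnected (hR : ∀ x y, adj x y → adj y x) {X : Finset ι} (hX : X.Nonempty) : IsConn adj X ↔ IsRConnected adj X :=
  ⟨isRConnected_of_isConn hR hX, isConn_of_isRConnected⟩

end Bridge

section Polys

/-! `BIJ88Ineq5113Covering.polys` lives in `Type`; so do the statements mentioning it. -/

variable {ι : Type} [DecidableEq ι] {adj : ι → ι → Prop} [DecidableRel adj]

/-- **gen 5/6's polymer family is the family of connected polymers**: `polys adj W` (nonempty `adj`-path-connected subsets of `W`) = the nonempty
subsets of `W` that are single clusters. [cite: BalabanImbrieJaffe1988, p.309 (Sect. 5.14)] -/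
theorem polys_eq_filter_isConn (hR : ∀ x y, adj x y → adj y x) (W : Finset ι) : polys adj W = (polysOf W).filter (IsConn adj) := by
  ext X
  rw [mem_polys, mem_filter, polysOf, mem_filter, mem_powerset]
  constructor
  · rintro ⟨hXW, hc⟩
    exact ⟨⟨hXW, hc.1⟩, isConn_of_isRConnected hc⟩
  · rintro ⟨⟨hXW, hne⟩, hc⟩
    exact ⟨hXW, isRConnected_of_isConn hR hne hc⟩

omit [DecidableEq ι] [DecidableRel adj] in
/-- connected polymers are polymers: `polys adj W ⊆ polysOf W`. [cite: BalabanImbrieJaffe1988, p.309 (Sect. 5.14)] -/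
theorem polys_subset_polysOf (W : Finset ι) : polys adj W ⊆ polysOf W := fun X hX => by
  obtain ⟨hXW, hc⟩ := mem_polys.1 hX
  exact mem_filter.2 ⟨mem_powerset.2 hXW, hc.1⟩

end Polys

/-! ## §2 `N(K)` does not see the polymers on which the activity vanishes -/

section Restrict

variable {V : Type*} {S : Type*} [DecidableEq V] [Fintype V] [DecidableEq S] [Fintype S]

/-- **restriction of the polymer family**: if `Q' ⊆ Q ∌ ∅` and the activity vanishes, for every slot set, on the polymers of `Q ∖ Q'`, then gen 6's
`N(K)` over `Q` equals `N(K)` over `Q'`. [cite: BalabanImbrieJaffe1988, p.309 (Sect. 5.14)] -/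
theorem Nsum_restrict {Q Q' : Finset (Finset V)} (hQ'Q : Q' ⊆ Q) (hQ : ∅ ∉ Q) (loc : S → V) {w : Finset S → Finset V → ℝ}
    (hw : ∀ X ∈ Q, X ∉ Q' → ∀ H, w H X = 0) (K : Finset S) : Nsum Q loc w K = Nsum Q' loc w K := by
  rw [Nsum_eq_sum_families (Q := Q) (loc := loc) (w := w) hQ,
    Nsum_eq_sum_families (Q := Q') (loc := loc) (w := w) fun h => hQ (hQ'Q h)]
  symm
  refine sum_subset (fun F hF => ?_) fun F hF hF' => ?_
  · rw [mem_filter, mem_powerset] at hF ⊢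
    exact ⟨hF.1.trans hQ'Q, hF.2⟩
  · rw [mem_filter, mem_powerset] at hF
    have hFQ' : ¬ F ⊆ Q' := fun h => hF' (mem_filter.2 ⟨mem_powerset.2 h, hF.2⟩)
    obtain ⟨X, hXF, hXQ'⟩ := not_subset.1 hFQ'
    exact prod_eq_zero hXF (hw X (hF.1 hXF) hXQ' _)

end Restrict

/-! ## §3 *"Each X_γ must cover and connect"*: `N(K)` over connected polymers, in both bookkeepings -/

section Connected

variable {ι : Type*} {S : Type*} [DecidableEq ι] [Fintype ι] {adj : ι → ι → Prop} [DecidableRel adj] [DecidableEq S] [Fintype S]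
  {loc : S → ι}

/-- **CLUSTER-CONFIGURATION BOOKKEEPING, connected polymers only**: gen 6's `N(K)` over the virtual supports (p. 310) of the CONNECTED polymers of
`W`, with the pulled-back prime-dropped derived activity, is the corner expectation `z K W W = ⟨Π_{j∈K}(d/dt)_{γ_j} Π_{i∈W} f(□_i)⟩_1` of (5.14.3)
(the disconnected polymers carry activity `0`, `BIJ88Expansion5143.prime_g3_eq_zero_of_not_isConn`). [cite: BalabanImbrieJaffe1988, (5.14.3) p.309] -/
theorem Nsum_vsupp_conn_eq_corner {W : Finset ι} {z : Finset S → Finset ι → Finset ι → ℝ} {K : Finset S}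
    (hz : IsClusterFactorizing adj (z K)) (hloc : IsSlotLocal loc z) (hK : ∀ j ∈ K, loc j ∈ W) :
    Nsum (((polysOf W).filter (IsConn adj)).image (cvsupp adj W)) (locv loc) (wv (prime (g3 adj z))) K = z K W W := by
  rw [← Nsum_vsupp_eq_corner hz hloc hK]
  symm
  refine Nsum_restrict (image_subset_image (filter_subset _ _)) empty_notMem_image_vsupp (locv loc) (fun Zv hZv hZv' H => ?_) K
  obtain ⟨X, hX, rfl⟩ := mem_image.1 hZv
  have hXc : ¬ IsConn adj X := fun hc => hZv' (mem_image_of_mem _ (mem_filter.2 ⟨hX, hc⟩))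
  have hXne : X.Nonempty := (mem_filter.1 hX).2
  have h2 : 2 ≤ X.card := by
    by_contra hlt
    have h1 : X.card = 1 := by have := hXne.card_pos; omega
    obtain ⟨c, rfl⟩ := card_eq_one.1 h1
    exact hXc (isConn_singleton adj c)
  rw [wv_vsupp]
  exact prime_g3_eq_zero_of_not_isConn z H h2 hXc

end Connected

section ConnectedPolys

variable {ι : Type} {S : Type*} [DecidableEq ι] [Fintype ι] {adj : ι → ι → Prop} [DecidableRel adj] [DecidableEq S] [Fintype S]
  {loc : S → ι}

/-- **OVERLAP BOOKKEEPING over gen 5/6's polymer family**: for a symmetric abutting relation, gen 6's `N(K)` over `polys adj W` (nonempty connected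
subsets, plain overlap hard core — the instantiation of `BIJ88RemainderW6Prime`) with the prime-dropped derived activity equals the sum over ALL
fillings of `W` of `Π_{X∈P} g₃(H(X), X)` — the right side of (5.14.3) in its printed all-fillings form. [cite: BalabanImbrieJaffe1988, (5.14.3) p.309] -/
theorem Nsum_polys_eq_sum_setPartitions (hR : ∀ x y, adj x y → adj y x) {W : Finset ι} (z : Finset S → Finset ι → Finset ι → ℝ)
    {K : Finset S} (hK : ∀ j ∈ K, loc j ∈ W) :
    Nsum (polys adj W) loc (prime (g3 adj z)) K = ∑ P ∈ setPartitions W, ∏ X ∈ P, g3 adj z (slotsIn loc K X) X := by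
  rw [← Nsum_eq_sum_setPartitions loc (g3 adj z) hK]
  symm
  refine Nsum_restrict (polys_subset_polysOf W) (empty_notMem_polysOf W) loc (fun X hX hX' H => ?_) K
  rw [polys_eq_filter_isConn hR] at hX'
  have hXc : ¬ IsConn adj X := fun hc => hX' (mem_filter.2 ⟨hX, hc⟩)
  have hXne : X.Nonempty := (mem_filter.1 hX).2
  have h2 : 2 ≤ X.card := by
    by_contra hlt
    have h1 : X.card = 1 := by have := hXne.card_pos; omega
    obtain ⟨c, rfl⟩ := card_eq_one.1 h1
    exact hXc (isConn_singleton adj c)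
  exact prime_g3_eq_zero_of_not_isConn z H h2 hXc

/-- **the two bookkeepings compared**: for slot-local cluster-factorizing corner data and a symmetric abutting relation, gen 6's `N(K)` over
`polys adj W` with the plain overlap hard core equals the corner expectation `z K W W` of (5.14.3) PLUS the contribution of the fillings of `W` that
violate the hard core among multi-cube polymers (two distinct polymers of at least two cubes containing abutting cubes) — the over-count of the
all-set-partitions reading recorded in READING NOTE G-C2-p25-03 (`BIJ88PolymerRep5134.sum_setPartitions_eq`). [cite: BalabanImbrieJaffe1988, (5.14.3) p.309] -/
theorem Nsum_polys_eq_corner_add (hR : ∀ x y, adj x y → adj y x) {W : Finset ι} {z : Finset S → Finset ι → Finset ι → ℝ} {K : Finset S}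
    (hz : IsClusterFactorizing adj (z K)) (hloc : IsSlotLocal loc z) (hK : ∀ j ∈ K, loc j ∈ W) :
    Nsum (polys adj W) loc (prime (g3 adj z)) K =
      z K W W + ∑ P ∈ (setPartitions W).filter (fun P => ¬ IsAdmissible adj P), ∏ X ∈ P, g3 adj z (slotsIn loc K X) X := by
  rw [Nsum_polys_eq_sum_setPartitions hR z hK, expansion5143 hz hloc W, sum_filter_add_sum_filter_not]

end ConnectedPolys

end Literature.MathematicalPhysics.QuantumFieldTheory.BalabanImbrieJaffe1984to88.BIJ88Expansion5143Connected
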